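import Summits.QuantumAdvantage.QuantumAdvantage.Theorems.OddPrimeWalkSimplexFrames

/-!
# The design configuration across a separator has a lost pair (engine for item stmt-QuantumAdvantage-24031 `FarDegreePairLaw`)

Cell qa-qnc0, route OddPrimeWalk; prover qn-prover-3 g18 (planner qa-qnc0-p2 g29 ROUND-29 §4.5 / INBOX 03:53Z check (1)).

Index type `Fin 3 × NW (d+1)` (frame × non-empty subset; odd size `3(2^(d+1) − 1)`).  Slots: `rA ⊕ fsum (frame t) W` on the near side
(frames on `[m − gLen d, m)`, base `rA` supported below `m − gLen d`) and `rB ⊕ fsum (frame t) W` on the far side (frames on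
`[m, m + gLen d)`, base `rB` supported from `m + gLen d` on).  THEOREM `design_exists_lose`: if the `A`-cuts have vanishing
`(d+1)`-subcube parities in the far bits and the `B`-cuts in the near bits (the filed hypotheses of `FarDegreePairLaw`), some glued
slot pair is LOST.  Proof = the planner's `configParity` with `hindA/hindB` from: slot classes `≡ |r| + frameRes t` (`wtB_slot`,
`wtA_slot`), every frame's non-empty parallelepiped part has the parity of `f(base)` (`sum_nonempty_eq` + `ppsum_eq_zero`), and
exactly one frame per residue class (`count_parity`, `card_frameRes_eq_one`).
WHAT THIS IS NOT: instrument; separation NOT moved.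
-/

namespace Summit.QuantumAdvantage.AdviceFreeQNC0.OddConfig

open Finset Classical

variable {n : ℕ}

/-! ### §1 The index type of a design configuration: frame × non-empty subset -/

/-- non-empty subsets of `Fin D`. -/
abbrev NW (D : ℕ) : Type := {W : Finset (Fin D) // W.Nonempty}

/-- there are `2^D − 1` non-empty subsets. -/
theorem card_NW (D : ℕ) : Fintype.card (NW D) = 2 ^ D - 1 := by
  rw [Fintype.card_subtype]
  have e : (univ.filter fun W : Finset (Fin D) => W.Nonempty) = univ.erase ∅ := by
    ext W; simp [nonempty_iff_ne_empty]
  rw [e, card_erase_of_mem (mem_univ _), card_univ, Fintype.card_finset, Fintype.card_fin]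

/-- the design index type `Fin 3 × NW (d+1)` has odd size `3·(2^(d+1) − 1)`. -/
theorem card_index_odd (d : ℕ) : Fintype.card (Fin 3 × NW (d + 1)) % 2 = 1 := by
  rw [Fintype.card_prod, Fintype.card_fin, card_NW]
  have h : 2 ^ (d + 1) = 2 * 2 ^ d := by rw [pow_succ, mul_comm]
  have hpos : 0 < 2 ^ d := Nat.two_pow_pos d
  omega

/-- sums over `NW D` are sums over the non-empty subsets. -/
theorem sum_NW {D : ℕ} (F : Finset (Fin D) → ZMod 2) :
    (∑ W : NW D, F W.1) = ∑ W ∈ (univ : Finset (Finset (Fin D))).filter (fun W => W.Nonempty), F W :=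
  (sum_subtype ((univ : Finset (Finset (Fin D))).filter (fun W => W.Nonempty)) (fun W => by simp) F).symm

/-- **generic class-count parity**: if the three frames land in distinct residue classes and every frame's non-empty
parallelepiped part has parity `x`, then every class count has parity `x`. -/
theorem count_parity {D : ℕ} (res : Fin 3 → ℕ) (hres : ∀ b < 3, (univ.filter fun t : Fin 3 => res t % 3 = b).card = 1)
    (fire : Fin 3 → Finset (Fin D) → Bool) (x : ZMod 2)
    (hfire : ∀ t, (∑ W ∈ (univ : Finset (Finset (Fin D))).filter (fun W => W.Nonempty), indZ (fire t W)) = x)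
    (cls : Fin 3 × NW D → ℕ) (hcls : ∀ j, cls j % 3 = res j.1 % 3) {b : ℕ} (hb : b < 3) :
    (((univ.filter fun j : Fin 3 × NW D => cls j % 3 = b ∧ fire j.1 j.2.1 = true).card : ℕ) : ZMod 2) = x := by
  rw [natCast_card_filter, Fintype.sum_prod_type]
  have hinner : ∀ t : Fin 3, (∑ W : NW D, (if cls (t, W) % 3 = b ∧ fire t W.1 = true then (1 : ZMod 2) else 0))
      = if res t % 3 = b then x else 0 := by
    intro t
    by_cases h : res t % 3 = b
    · rw [if_pos h, ← hfire t, ← sum_NW]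
      refine sum_congr rfl fun W _ => ?_
      rw [hcls (t, W)]; simp [h, indZ]
    · rw [if_neg h]
      refine sum_eq_zero fun W _ => ?_
      rw [hcls (t, W)]; simp [h]
  simp_rw [hinner]
  rw [← sum_filter, sum_const, hres b hb, one_smul]

/-! ### §2 The design configuration across a separator and its lost pair -/

section Design

variable {m d : ℕ}

/-- weights of far design slots: base `r` (far-supported, vanishing on the far ground block) plus a frame partial sum. -/
theorem wtB_slot (hnB : m + gLen d ≤ n) (rB : Fin n → Bool) (hrB : ∀ k, rB k = true → m + gLen d ≤ k.val)
    (t : Fin 3) (W : NW (d + 1)) :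
    wtB m (addV rB (fsum (frame hnB t) W.1)) % 3 = (wtB m rB + frameRes d t) % 3 := by
  have hsupp := fsum_supp (frame hnB t) (fun j k hk => frame_supp hnB t j k hk) W.1
  rw [wtB_addV_of_disjoint, wtB_eq_wt_of_far m (fsum (frame hnB t) W.1) (fun k hk => (hsupp k hk).1), Nat.add_mod,
    wt_fsum_frame_mod hnB t W.2, ← Nat.add_mod]
  intro i ⟨h1, h2⟩
  have a := hrB i h1; have b := (hsupp i h2).2; omega

/-- weights of near design slots. -/
theorem wtA_slot (hgm : gLen d ≤ m) (hnA : (m - gLen d) + gLen d ≤ n) (rA : Fin n → Bool)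
    (hrA : ∀ k, rA k = true → k.val < m - gLen d) (t : Fin 3) (W : NW (d + 1)) :
    wtA m (addV rA (fsum (frame hnA t) W.1)) % 3 = (wtA m rA + frameRes d t) % 3 := by
  have hsupp := fsum_supp (frame hnA t) (fun j k hk => frame_supp hnA t j k hk) W.1
  rw [wtA_addV_of_disjoint, wtA_eq_wt_of_near m (fsum (frame hnA t) W.1) (fun k hk => by have := (hsupp k hk).2; omega),
    Nat.add_mod,
    wt_fsum_frame_mod hnA t W.2, ← Nat.add_mod]
  intro i ⟨h1, h2⟩
  have a := hrA i h1; have b := (hsupp i h2).1; omega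

/-- **THE DESIGN CONFIGURATION HAS A LOST PAIR.**  Far cuts of bounded far-degree (`A`-cuts `g ≤ m`: all `(d+1)`-subcube parities in
the far bits vanish) and near cuts of bounded near-degree, a near base `rA` (supported below `m − gLen d`) and a far base `rB`
(supported from `m + gLen d` on): among the glued pairs of the slots `rA ⊕ fsum (frame t) W`, `rB ⊕ fsum (frame t') W'`
(`W, W' ≠ ∅`) at least one is LOST. -/
theorem design_exists_lose (c : ℕ) (y : Fin (n + 1) → (Fin n → Bool) → Bool)
    (hgm : gLen d ≤ m) (hnB : m + gLen d ≤ n)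
    (hfarA : ∀ g : Fin (n + 1), g.val ≤ m → ∀ u : Fin n → Bool, ∀ S : Finset (Fin n), S.card = d + 1 →
      (∀ i ∈ S, m ≤ i.val) →
      (S.powerset.filter fun T => y g (fun i => Bool.xor (u i) (decide (i ∈ T))) = true).card % 2 = 0)
    (hfarB : ∀ g : Fin (n + 1), m < g.val → ∀ u : Fin n → Bool, ∀ S : Finset (Fin n), S.card = d + 1 →
      (∀ i ∈ S, i.val < m) →
      (S.powerset.filter fun T => y g (fun i => Bool.xor (u i) (decide (i ∈ T))) = true).card % 2 = 0)
    (rA rB : Fin n → Bool) (hrA : ∀ k, rA k = true → k.val < m - gLen d) (hrB : ∀ k, rB k = true → m + gLen d ≤ k.val) :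
    ∃ i j : Fin 3 × NW (d + 1),
      ringWinU c y (glue m (addV rA (fsum (frame (show (m - gLen d) + gLen d ≤ n by omega) i.1) i.2.1))
        (addV rB (fsum (frame hnB j.1) j.2.1))) = false := by
  have hnA : (m - gLen d) + gLen d ≤ n := by omega
  -- supports
  have hsA : ∀ (t : Fin 3) (W : Finset (Fin (d + 1))) (k : Fin n), fsum (frame hnA t) W k = true → k.val < m := by
    intro t W k hk
    have := (fsum_supp (frame hnA t) (fun j k hk => frame_supp hnA t j k hk) W k hk).2; omega
  have hsB : ∀ (t : Fin 3) (W : Finset (Fin (d + 1))) (k : Fin n), fsum (frame hnB t) W k = true → m ≤ k.val := by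
    intro t W k hk
    have := (fsum_supp (frame hnB t) (fun j k hk => frame_supp hnB t j k hk) W k hk).1; omega
  refine configParity m c y (fun i : Fin 3 × NW (d + 1) => addV rA (fsum (frame hnA i.1) i.2.1))
    (fun j : Fin 3 × NW (d + 1) => addV rB (fsum (frame hnB j.1) j.2.1)) (card_index_odd d) (card_index_odd d) ?_ ?_
  · -- cuts `g ≤ m`: far parallelepipeds
    intro g hg i b hb
    set u : Fin n → Bool := glue m (addV rA (fsum (frame hnA i.1) i.2.1)) rB with hu
    have hglue : ∀ (t : Fin 3) (W : Finset (Fin (d + 1))),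
        glue m (addV rA (fsum (frame hnA i.1) i.2.1)) (addV rB (fsum (frame hnB t) W)) = addV u (fsum (frame hnB t) W) := by
      intro t W
      rw [hu, ← glue_addV_far]
      intro k hk
      by_contra h
      have := hsB t W k (by simpa using h); omega
    have hfire : ∀ t : Fin 3, (∑ W ∈ (univ : Finset (Finset (Fin (d + 1)))).filter (fun W => W.Nonempty),
        indZ (y g (addV u (fsum (frame hnB t) W)))) = indZ (y g u) := by
      intro t
      refine sum_nonempty_eq (y g) u (frame hnB t) ?_
      exact ppsum_eq_zero (y g) (fun k : Fin n => m ≤ k.val) (hfarA g hg) _ u (frame hnB t) rfl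
        (fun j k hk => (frame_supp hnB t j k hk).1)
    have key := fun b' (hb' : b' < 3) => count_parity (fun t => wtB m rB + frameRes d t)
      (fun b'' hb'' => card_frameRes_eq_one d (wtB m rB) hb'')
      (fun t W => y g (addV u (fsum (frame hnB t) W))) (indZ (y g u)) hfire
      (fun j => wtB m (addV rB (fsum (frame hnB j.1) j.2.1))) (fun j => wtB_slot hnB rB hrB j.1 j.2) hb'
    have e : ∀ b', (univ.filter fun j : Fin 3 × NW (d + 1) =>
        wtB m (addV rB (fsum (frame hnB j.1) j.2.1)) % 3 = b' ∧
          y g (glue m (addV rA (fsum (frame hnA i.1) i.2.1)) (addV rB (fsum (frame hnB j.1) j.2.1))) = true)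
        = univ.filter fun j : Fin 3 × NW (d + 1) =>
          wtB m (addV rB (fsum (frame hnB j.1) j.2.1)) % 3 = b' ∧ y g (addV u (fsum (frame hnB j.1) j.2.1)) = true := by
      intro b'; congr 1; funext j; rw [hglue]
    rw [e, e]
    exact (ZMod.natCast_eq_natCast_iff' _ _ 2).mp ((key b hb).trans (key 0 (by norm_num)).symm)
  · -- cuts `g > m`: near parallelepipeds
    intro g hg j a ha
    set u : Fin n → Bool := glue m rA (addV rB (fsum (frame hnB j.1) j.2.1)) with hu
    have hglue : ∀ (t : Fin 3) (W : Finset (Fin (d + 1))),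
        glue m (addV rA (fsum (frame hnA t) W)) (addV rB (fsum (frame hnB j.1) j.2.1)) = addV u (fsum (frame hnA t) W) := by
      intro t W
      rw [hu, ← glue_addV_near]
      intro k hk
      by_contra h
      have := hsA t W k (by simpa using h); omega
    have hfire : ∀ t : Fin 3, (∑ W ∈ (univ : Finset (Finset (Fin (d + 1)))).filter (fun W => W.Nonempty),
        indZ (y g (addV u (fsum (frame hnA t) W)))) = indZ (y g u) := by
      intro t
      refine sum_nonempty_eq (y g) u (frame hnA t) ?_
      exact ppsum_eq_zero (y g) (fun k : Fin n => k.val < m) (hfarB g hg) _ u (frame hnA t) rfl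
        (fun j k hk => by have := (frame_supp hnA t j k hk).2; omega)
    have key := fun a' (ha' : a' < 3) => count_parity (fun t => wtA m rA + frameRes d t)
      (fun b'' hb'' => card_frameRes_eq_one d (wtA m rA) hb'')
      (fun t W => y g (addV u (fsum (frame hnA t) W))) (indZ (y g u)) hfire
      (fun i => wtA m (addV rA (fsum (frame hnA i.1) i.2.1))) (fun i => wtA_slot hgm hnA rA hrA i.1 i.2) ha'
    have e : ∀ a', (univ.filter fun i : Fin 3 × NW (d + 1) =>
        wtA m (addV rA (fsum (frame hnA i.1) i.2.1)) % 3 = a' ∧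
          y g (glue m (addV rA (fsum (frame hnA i.1) i.2.1)) (addV rB (fsum (frame hnB j.1) j.2.1))) = true)
        = univ.filter fun i : Fin 3 × NW (d + 1) =>
          wtA m (addV rA (fsum (frame hnA i.1) i.2.1)) % 3 = a' ∧ y g (addV u (fsum (frame hnA i.1) i.2.1)) = true := by
      intro a'; congr 1; funext i; rw [hglue]
    rw [e, e]
    exact (ZMod.natCast_eq_natCast_iff' _ _ 2).mp ((key a ha).trans (key 0 (by norm_num)).symm)

end Design

end Summit.QuantumAdvantage.AdviceFreeQNC0.OddConfig
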